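import Literature.NumberTheory.Sieve.Maynard2016Lemma93MainSkeleton
import Literature.NumberTheory.Sieve.Maynard2016Lemma93EmSummation
import Literature.NumberTheory.Sieve.Maynard2016Lemma82
import HarnessLib

/-!
# Maynard 2016, proof of Lemma 9.3 — the error chain (display (9.26) and the first display of p. 24)

Sources: J. Maynard, *Dense clusters of primes in subsets*, Compositio Math. 152 (2016) 1517–1554 =
arXiv:1405.2593 [Maynard2016DenseClusters], proof of Lemma 9.3, p. 24 (display (9.26) and the
un-numbered first display of p. 24, «We first estimate the error term from (9.26) …»);
K. Ford, B. Green, S. Konyagin, J. Maynard, T. Tao, *Long gaps between primes*, JAMS 31 (2018)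
[FordGreenKonyaginMaynardTao2018], §7 (7.5), (7.8) and Theorem 6 (7.13).

`Maynard2016Lemma93MainSkeleton` (`FGKMT2018.yVarM_eq_main_add_err`) splits `y^{(m)}_r` exactly into a
MAIN part (evaluated by (9.27)–(9.30)) and the ERROR part of (9.26),
`(∏r/φ_L(∏r)) ∑_c (1/φ_ω(c)) ∑_{q ∈ qBox} (y_{r[m↦c]⊙q} − y_{r[m↦c]}) σ(q)/φ_ω(∏q)`.
By Lemma 8.2 (tree `FGKMT2018.abs_yVar_sub_yVar_le`), `|y_{r'⊙q} − y_{r'}| ≪ T_k Y_{r'} (log ∏q)/log R`,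
so the inner sum to control is the LOG-WEIGHTED absolute Euler sum
`∑_{q ∈ qBox} |σ(q)|/φ_ω(∏q) · log ∏qᵢ` — Maynard's `∑_{s,t} (log st)/(φ(s)φ_ω(st))`. This file proves:

* §1 an exact formula for log-weighted sums over `qBox` of a weight multiplicative under prime insertion
  (`sum_qBox_mul_log_prod_eq`): with `E_p` the Euler factors of `FGKMT2018.sum_qBox_prod_eq`,
  `∑_{q ∈ qBox(∏_{p∈s} p)} w(q) log ∏q = w(1) ∑_{p∈s} (E_p − 1) log p ∏_{p'∈s∖{p}} E_{p'}` («we substitute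
  `log A = ∑_{p∣A} log p`, `A = pA'`, and swap the order of summation», p. 22), and the bound
  `≤ w(1) (∏_{p∈s} E_p) ∑_{p∈s} (E_p − 1) log p` for factors `E_p ≥ 1` (`sum_qBox_mul_log_prod_le`);
* §2 the absolute weight `|σ(q)|/φ_ω(∏q)`: multiplicativity (`abs_sigmaM_div_phiOmega_update_mul`), the census
  `∑_{j ∈ admIdx(p)∖{m}} |S'^{(m)}_p(j)| = [p ∤ a_m]((ω(p) − 1)/(p − 1) + [m ∉ admIdx(p)])`
  (`sum_erase_abs_sPrimeM_eq`, the absolute twin of `FGKMT2018.sum_erase_sPrimeM_eq`), the explicit Euler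
  factor (`eulerFactorM_abs_sPrime`), and the arithmetic of the `t`-indices: `m ∉ admIdx(p)`, `p ∤ a_m`
  forces `p ∣ Δ*_m := ∏_{j≠m} |a_j b_m − a_m b_j|` (`dvd_prod_crossDet_of_not_mem_admIdx`; Maynard's
  «if `p ∣ W'_j/W_j` then `p ∣ a_m b_j − a_j b_m`»), `Δ*_m ≠ 0` for non-degenerate `𝓛`;
* §3 the bound of the first display of p. 24: for admissible non-degenerate `𝓛`, `k ≥ 2`, square-free `N`,
  every `m`, `M`:
  `∑_{q ∈ qBox N m M} |σ(q)|/φ_ω(∏q) · log ∏q ≤ K · ∏_{p∣Δ*_m}(1 + 1/p) · (1 + ∑_{p∣Δ*_m} log p/p)`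
  with the absolute `K = 2e⁶e^{2e⁶}` (`sum_qBox_abs_sigmaM_log_le`) — the `s`-part is `O(1)` by the tree's
  `MaynardDense.sum_sqfree_coprime_pow_mul_log_div_le` («since there are `O(ω(u))` choices of `𝐬` with `s = u`,
  and we only consider primes `p > 2k²`»), the `t`-part is supported on the primes of `Δ*_m`
  («we are summing over square-free `t ∣ Δ`»). The printed `≪ (log log Δ)² ≪ (log log R)²` is then the frame
  bound `∏_{p∣Δ}(1+1/p) ≪ log log Δ`, `∑_{p∣Δ} log p/p ≪ log log Δ`, `Δ ≪ x^{O(k)}` (left to the assembler,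
  exactly as for `MaynardDense.sum_divisors_log_div_phiOmega_le`).

No new definitions and no named facts.

## References
* J. Maynard, *Dense clusters of primes in subsets*, Compositio Math. 152 (2016), proof of Lemma 9.3
  p. 24, (9.26) and the first display of p. 24; proof of Prop. 9.2 p. 22 («swap the order of summation»)
  [Maynard2016DenseClusters].
* K. Ford, B. Green, S. Konyagin, J. Maynard, T. Tao, *Long gaps between primes*, JAMS 31 (2018), §7 (7.5),
  (7.8), Thm 6 (7.13) [FordGreenKonyaginMaynardTao2018].
-/

noncomputable section

open Finset
open scoped Nat

namespace Literature.NumberTheory.Sieve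

namespace FGKMT2018

variable {k : ℕ}

/-! ### §1 Log-weighted Euler sums on `qBox` -/

/-- With one prime more in the modulus (`p ∤ N`): the `q ∈ qBox(N·p)` with `p ∤ ∏ qᵢ` are exactly `qBox(N)`.
[cite: Maynard2016DenseClusters, proof of Lemma 9.3 p. 24, (9.27) («by multiplicativity»)] -/
theorem filter_qBox_mul_not_dvd {L : Fin k → ℤ × ℤ} {B N : ℕ} (hN : N ≠ 0) {p : ℕ} (hp : p.Prime)
    (hpN : ¬ p ∣ N) (m : Fin k) (M : ℕ) :
    (qBox L B (N * p) m M).filter (fun q => ¬ p ∣ ∏ i, q i) = qBox L B N m M := by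
  ext q
  simp only [Finset.mem_filter, mem_qBox_iff]
  constructor
  · rintro ⟨⟨hq, hm, hM⟩, hnd⟩
    exact ⟨mem_admBoxN_of_mem_mul_of_not_dvd hN hp hq hnd, hm, hM⟩
  · rintro ⟨hq, hm, hM⟩
    exact ⟨⟨admBoxN_subset_mul hN hp.ne_zero hq, hm, hM⟩, not_dvd_prod_of_mem_admBoxN hN hp hpN hq⟩

/-- `log n = ∑_{p ∣ n} log p` for square-free `n` («we substitute `log A = ∑_{p∣A} log p`»).
[cite: Maynard2016DenseClusters, proof of Prop. 9.2 p. 22] -/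
theorem log_eq_sum_primeFactors_log {n : ℕ} (hn : Squarefree n) :
    Real.log (n : ℝ) = ∑ p ∈ n.primeFactors, Real.log p := by
  conv_lhs => rw [← Nat.prod_primeFactors_of_squarefree hn]
  rw [Nat.cast_prod, Real.log_prod]
  intro p hp
  exact_mod_cast (Nat.prime_of_mem_primeFactors hp).ne_zero

/-- **Log-weighted Euler sum, exact form**: for a weight `w` multiplicative under prime insertion with Euler
factors `E_p = 1 + [p ∤ WB·M] ∑_{j ∈ admIdx(p)∖{m}} w_p(j)` (`FGKMT2018.eulerFactorM`),
`∑_{q ∈ qBox(∏_{p∈s} p)} w(q) log(∏ qᵢ) = w(1) ∑_{p ∈ s} (E_p − 1) log p ∏_{p' ∈ s∖{p}} E_{p'}`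
(substitute `log ∏q = ∑_{p ∣ ∏q} log p`, swap the summations, and evaluate the `q`-sum with `p ∣ ∏q` as
`∑_{qBox(∏s)} w − ∑_{qBox(∏(s∖p))} w` by `FGKMT2018.sum_qBox_prod_eq`).
[cite: Maynard2016DenseClusters, proof of Lemma 9.3 p. 24 (first display, «the sum over s then factorizes as an Euler product»); proof of Prop. 9.2 p. 22 («swap the order of summation»)] -/
theorem sum_qBox_mul_log_prod_eq {L : Fin k → ℤ × ℤ} {B : ℕ} (s : Finset ℕ) (hs : ∀ p ∈ s, p.Prime)
    (m : Fin k) (M : ℕ) (w : (Fin k → ℕ) → ℝ) (wloc : ℕ → Fin k → ℝ)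
    (hw : ∀ p ∈ s, ∀ q : Fin k → ℕ, (∀ i, 1 ≤ q i) → ¬ p ∣ ∏ i, q i →
      ∀ j, w (Function.update q j (q j * p)) = w q * wloc p j) :
    ∑ q ∈ qBox L B (∏ p ∈ s, p) m M, w q * Real.log ((∏ i, q i : ℕ) : ℝ) =
      w (fun _ => 1) * ∑ p ∈ s, (eulerFactorM L B m M wloc p - 1) * Real.log p *
        ∏ p' ∈ s.erase p, eulerFactorM L B m M wloc p' := by
  classical
  set N : ℕ := ∏ p ∈ s, p with hNdef
  have hN : N ≠ 0 := Finset.prod_ne_zero_iff.2 fun p hp => (hs p hp).ne_zero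
  -- Step 1: `log ∏q = ∑_{p ∈ s} [p ∣ ∏q] log p` on `qBox N`
  have hlog : ∀ q ∈ qBox L B N m M,
      Real.log ((∏ i, q i : ℕ) : ℝ) = ∑ p ∈ s, if p ∣ ∏ i, q i then Real.log p else 0 := by
    intro q hq
    have hqN := (mem_qBox_iff.1 hq).1
    obtain ⟨hdiv, hsq, -, -⟩ := (mem_admBoxN_iff hN).1 hqN
    rw [log_eq_sum_primeFactors_log hsq, ← Finset.sum_filter]
    refine Finset.sum_congr ?_ fun _ _ => rfl
    ext p
    rw [Finset.mem_filter, Nat.mem_primeFactors_of_ne_zero hsq.ne_zero]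
    constructor
    · rintro ⟨hp, hpd⟩
      refine ⟨?_, hpd⟩
      obtain ⟨i, -, hi⟩ := (Prime.dvd_finsetProd_iff hp.prime _).1 hpd
      have hpN : p ∣ N := hi.trans (hdiv i)
      obtain ⟨p', hp', hpp'⟩ := (Prime.dvd_finsetProd_iff hp.prime _).1 hpN
      rwa [(Nat.prime_dvd_prime_iff_eq hp (hs p' hp')).1 hpp']
    · rintro ⟨hp, hpd⟩
      exact ⟨hs p hp, hpd⟩
  -- Step 2: the `q`-sum with `p ∣ ∏q`
  have hpart : ∀ p ∈ s, ∑ q ∈ (qBox L B N m M).filter (fun q => p ∣ ∏ i, q i), w q =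
      w (fun _ => 1) * ((eulerFactorM L B m M wloc p - 1) *
        ∏ p' ∈ s.erase p, eulerFactorM L B m M wloc p') := by
    intro p hp
    have hpP := hs p hp
    have hs' : ∀ p' ∈ s.erase p, p'.Prime := fun p' hp' => hs p' (Finset.mem_of_mem_erase hp')
    have hN' : (∏ p' ∈ s.erase p, p') ≠ 0 :=
      Finset.prod_ne_zero_iff.2 fun p' hp' => (hs' p' hp').ne_zero
    have hpN' : ¬ p ∣ ∏ p' ∈ s.erase p, p' := by
      intro h
      obtain ⟨p', hp'm, hpp'⟩ := (Prime.dvd_finsetProd_iff hpP.prime _).1 h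
      have := (Nat.prime_dvd_prime_iff_eq hpP (hs' p' hp'm)).1 hpp'
      exact (Finset.ne_of_mem_erase hp'm) this.symm
    have hNeq : N = (∏ p' ∈ s.erase p, p') * p := by
      rw [hNdef, mul_comm]
      exact (Finset.mul_prod_erase s (fun x => x) hp).symm
    have hsplit := Finset.sum_filter_add_sum_filter_not (qBox L B N m M) (fun q => p ∣ ∏ i, q i) w
    have hnot : ∑ q ∈ (qBox L B N m M).filter (fun q => ¬ p ∣ ∏ i, q i), w q =
        w (fun _ => 1) * ∏ p' ∈ s.erase p, eulerFactorM L B m M wloc p' := by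
      rw [hNeq, filter_qBox_mul_not_dvd hN' hpP hpN' m M,
        sum_qBox_prod_eq (s.erase p) hs' m M w wloc fun p' hp' => hw p' (Finset.mem_of_mem_erase hp')]
    have hall := sum_qBox_prod_eq (L := L) (B := B) s hs m M w wloc hw
    rw [← hNdef, ← Finset.mul_prod_erase s (eulerFactorM L B m M wloc) hp] at hall
    have hfil : ∑ q ∈ (qBox L B N m M).filter (fun q => p ∣ ∏ i, q i), w q =
        ∑ q ∈ qBox L B N m M, w q -
          ∑ q ∈ (qBox L B N m M).filter (fun q => ¬ p ∣ ∏ i, q i), w q := by linarith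
    rw [hfil, hall, hnot]
    ring
  -- Step 3: swap the summations
  calc ∑ q ∈ qBox L B N m M, w q * Real.log ((∏ i, q i : ℕ) : ℝ)
      = ∑ q ∈ qBox L B N m M, ∑ p ∈ s, (if p ∣ ∏ i, q i then w q * Real.log p else 0) := by
        refine Finset.sum_congr rfl fun q hq => ?_
        rw [hlog q hq, Finset.mul_sum]
        refine Finset.sum_congr rfl fun p _ => ?_
        split_ifs
        · rfl
        · rw [mul_zero]
    _ = ∑ p ∈ s, ∑ q ∈ qBox L B N m M, (if p ∣ ∏ i, q i then w q * Real.log p else 0) :=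
        Finset.sum_comm
    _ = ∑ p ∈ s, Real.log p * ∑ q ∈ (qBox L B N m M).filter (fun q => p ∣ ∏ i, q i), w q := by
        refine Finset.sum_congr rfl fun p _ => ?_
        rw [Finset.sum_filter, Finset.mul_sum]
        refine Finset.sum_congr rfl fun q _ => ?_
        split_ifs
        · ring
        · rw [mul_zero]
    _ = _ := by
        rw [Finset.mul_sum]
        refine Finset.sum_congr rfl fun p hp => ?_
        rw [hpart p hp]
        ring

/-- **Log-weighted Euler sum, upper bound**: if `w(1) ≥ 0` and all Euler factors satisfy `E_p ≥ 1` (e.g.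
non-negative local weights), then
`∑_{q ∈ qBox(∏_{p∈s} p)} w(q) log(∏ qᵢ) ≤ w(1) (∏_{p∈s} E_p) ∑_{p∈s} (E_p − 1) log p`.
[cite: Maynard2016DenseClusters, proof of Lemma 9.3 p. 24 (first display)] -/
theorem sum_qBox_mul_log_prod_le {L : Fin k → ℤ × ℤ} {B : ℕ} (s : Finset ℕ) (hs : ∀ p ∈ s, p.Prime)
    (m : Fin k) (M : ℕ) (w : (Fin k → ℕ) → ℝ) (wloc : ℕ → Fin k → ℝ)
    (hw : ∀ p ∈ s, ∀ q : Fin k → ℕ, (∀ i, 1 ≤ q i) → ¬ p ∣ ∏ i, q i →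
      ∀ j, w (Function.update q j (q j * p)) = w q * wloc p j)
    (hw1 : 0 ≤ w (fun _ => 1)) (hE : ∀ p ∈ s, 1 ≤ eulerFactorM L B m M wloc p) :
    ∑ q ∈ qBox L B (∏ p ∈ s, p) m M, w q * Real.log ((∏ i, q i : ℕ) : ℝ) ≤
      w (fun _ => 1) * (∏ p ∈ s, eulerFactorM L B m M wloc p) *
        ∑ p ∈ s, (eulerFactorM L B m M wloc p - 1) * Real.log p := by
  rw [sum_qBox_mul_log_prod_eq s hs m M w wloc hw, mul_assoc]
  refine mul_le_mul_of_nonneg_left ?_ hw1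
  rw [Finset.mul_sum]
  refine Finset.sum_le_sum fun p hp => ?_
  have hEp := hE p hp
  have hlogp : 0 ≤ Real.log p := Real.log_nonneg (by exact_mod_cast (hs p hp).one_lt.le)
  have hnn : ∀ p' ∈ s, 0 ≤ eulerFactorM L B m M wloc p' := fun p' hp' => zero_le_one.trans (hE p' hp')
  have h1 : ∏ p' ∈ s.erase p, eulerFactorM L B m M wloc p' ≤ ∏ p' ∈ s, eulerFactorM L B m M wloc p' := by
    rw [← Finset.mul_prod_erase s _ hp]
    exact le_mul_of_one_le_left
      (Finset.prod_nonneg fun p' hp' => hnn p' (Finset.mem_of_mem_erase hp')) hEp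
  calc (eulerFactorM L B m M wloc p - 1) * Real.log p * ∏ p' ∈ s.erase p, eulerFactorM L B m M wloc p'
      ≤ (eulerFactorM L B m M wloc p - 1) * Real.log p * ∏ p' ∈ s, eulerFactorM L B m M wloc p' :=
        mul_le_mul_of_nonneg_left h1 (mul_nonneg (by linarith) hlogp)
    _ = (∏ p' ∈ s, eulerFactorM L B m M wloc p') * ((eulerFactorM L B m M wloc p - 1) * Real.log p) := by
        ring

/-! ### §2 The absolute weight `|σ^{(m)}(q)|/φ_ω(∏q)`: multiplicativity, census, Euler factor, `t`-indices -/

/-- The absolute weight is multiplicative under prime insertion: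
`(|σ|/φ_ω)(q·p@j) = (|σ|/φ_ω)(q) · |S'^{(m)}_p(j)|/(p − ω(p))` for `p ∤ ∏ qᵢ`, `qᵢ ≥ 1`, when `ω(p') < p'`
at every prime (admissible `𝓛`). [cite: Maynard2016DenseClusters, proof of Lemma 9.3 p. 24, (9.26)–(9.27)] -/
theorem abs_sigmaM_div_phiOmega_update_mul (L : Fin k → ℤ × ℤ)
    (hω : ∀ p : ℕ, p.Prime → omegaL L p < p) (m : Fin k) {q : Fin k → ℕ} (hq : ∀ i, 1 ≤ q i)
    {p : ℕ} (hp : p.Prime) (hpq : ¬ p ∣ ∏ i, q i) (j : Fin k) :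
    |sigmaM L m (Function.update q j (q j * p))| /
        phiOmega L (∏ i, Function.update q j (q j * p) i) =
      |sigmaM L m q| / phiOmega L (∏ i, q i) * (|sPrimeM L m j p| / ((p : ℝ) - omegaL L p)) := by
  have h := sigmaM_div_phiOmega_update_mul L m hq hp hpq j
  have hφ1 : 0 < phiOmega L (∏ i, Function.update q j (q j * p) i) :=
    phiOmega_pos_of_forall_lt L fun p' hp' => hω p' (Nat.prime_of_mem_primeFactors hp')
  have hφ2 : 0 < phiOmega L (∏ i, q i) :=
    phiOmega_pos_of_forall_lt L fun p' hp' => hω p' (Nat.prime_of_mem_primeFactors hp')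
  have hpω : 0 < (p : ℝ) - omegaL L p := by
    have : (omegaL L p : ℝ) < p := by exact_mod_cast hω p hp
    linarith
  have habs := congrArg (fun x : ℝ => |x|) h
  simp only [abs_div, abs_mul, abs_of_pos hφ1, abs_of_pos hφ2, abs_of_pos hpω] at habs
  exact habs

/-- **Census of the absolute local factors**:
`∑_{j ∈ admIdx(p) ∖ {m}} |S'^{(m)}_p(j)| = 0` if `p ∣ a_m`, and
`= (ω(p) − 1)/(p − 1) + [m ∉ admIdx(p)]` if `p ∤ a_m` (the `ω(p) − 1` indices with `S' = −1/(p−1)` and the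
at most one `t`-index with `S' = 1`). The absolute twin of `FGKMT2018.sum_erase_sPrimeM_eq`.
[cite: Maynard2016DenseClusters, proof of Lemma 9.3 p. 24, (9.27) and the first display («there are O(ω(u)) choices of s with s = u», «at most one possible t»)] -/
theorem sum_erase_abs_sPrimeM_eq {L : Fin k → ℤ × ℤ} (hadm : FormsAdmissible L) (m : Fin k) {p : ℕ}
    (hp : p.Prime) :
    ∑ j ∈ (admIdx L p).erase m, |sPrimeM L m j p| =
      if p ∣ (L m).1.natAbs then 0
      else ((omegaL L p : ℝ) - 1) / ((p : ℝ) - 1) + (if m ∈ admIdx L p then 0 else 1) := by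
  classical
  have hl : (L m).1 ≠ 0 := hadm.1 m
  have hcount := card_deltaIdx_add hadm m hp
  have hcardA := card_admIdxM_add hadm m hp
  have hp1 : (0 : ℝ) < (p : ℝ) - 1 := by
    have : (1 : ℝ) < p := by exact_mod_cast hp.one_lt
    linarith
  set Km := ((admIdx L p).erase m).filter (fun j => p ∣ (crossDet L m j).natAbs) with hKm
  have hsplit : ∑ j ∈ (admIdx L p).erase m, |sPrimeM L m j p| =
      ∑ j ∈ Km, |sPrimeM L m j p| + ∑ j ∈ admIdxM L m p, |sPrimeM L m j p| := by
    rw [← filter_erase_admIdx_not_dvd L m p, hKm, Finset.sum_filter_add_sum_filter_not]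
  have hK : ∑ j ∈ Km, |sPrimeM L m j p| = #Km := by
    rw [Finset.card_eq_sum_ones, Nat.cast_sum, Nat.cast_one]
    refine Finset.sum_congr rfl fun j hj => ?_
    rw [sPrimeM_of_dvd_crossDet L m j (Finset.mem_filter.1 hj).2, abs_one]
  have hA : ∑ j ∈ admIdxM L m p, |sPrimeM L m j p| =
      #(admIdxM L m p) * (if p ∣ (L m).1.natAbs then 0 else 1 / ((p : ℝ) - 1)) := by
    rw [Finset.card_eq_sum_ones, Nat.cast_sum, Finset.sum_mul, Nat.cast_one, one_mul]
    refine Finset.sum_congr rfl fun j hj => ?_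
    obtain ⟨-, hjm, hΔ⟩ := mem_admIdxM.1 hj
    rw [sPrimeM_of_not L hl hp (not_or.2 ⟨hjm, hΔ⟩)]
    split_ifs
    · exact abs_zero
    · rw [abs_div, abs_neg, abs_one, abs_of_pos hp1]
  rw [hsplit, hK, hA]
  by_cases hpa : p ∣ (L m).1.natAbs
  · rw [if_pos hpa] at hcount hcardA ⊢
    have hKm0 : #Km = 0 := by
      have : #Km + (if m ∈ admIdx L p then 1 else 0) = 0 := hcount
      split_ifs at this; omega
    rw [if_pos hpa, hKm0, Nat.cast_zero, mul_zero, add_zero]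
  · rw [if_neg hpa] at hcount hcardA ⊢
    rw [if_neg hpa]
    have hAc : (#(admIdxM L m p) : ℝ) = (omegaL L p : ℝ) - 1 := by
      have h := congrArg (fun n : ℕ => (n : ℝ)) hcardA
      simp only [Nat.cast_add, Nat.cast_one] at h
      linarith
    have hKc : (#Km : ℝ) = if m ∈ admIdx L p then 0 else 1 := by
      split_ifs at hcount ⊢ with hm
      · have : #Km = 0 := by omega
        rw [this, Nat.cast_zero]
      · have : #Km = 1 := by omega
        rw [this, Nat.cast_one]
    rw [hKc, hAc]
    ring

/-- **The Euler factor of the absolute weight** (`w_p(j) = |S'^{(m)}_p(j)|/(p − ω(p))`): for `p ∤ WB·M`,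
`E_p = 1` if `p ∣ a_m`, else `E_p = 1 + (ω(p) − 1)/((p − 1)(p − ω(p))) + [m ∉ admIdx(p)]/(p − ω(p))`;
`E_p = 1` for `p ∣ WB·M`. [cite: Maynard2016DenseClusters, proof of Lemma 9.3 p. 24, (9.27) and the first display] -/
theorem eulerFactorM_abs_sPrime {L : Fin k → ℤ × ℤ} (hadm : FormsAdmissible L) (B : ℕ) (m : Fin k)
    (M : ℕ) {p : ℕ} (hp : p.Prime) :
    eulerFactorM L B m M (fun p j => |sPrimeM L m j p| / ((p : ℝ) - omegaL L p)) p =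
      if p.Coprime (wCut k B * B) ∧ ¬ p ∣ M then
        (if p ∣ (L m).1.natAbs then 1
         else 1 + ((omegaL L p : ℝ) - 1) / (((p : ℝ) - 1) * ((p : ℝ) - omegaL L p)) +
           (if m ∈ admIdx L p then 0 else 1) / ((p : ℝ) - omegaL L p))
      else 1 := by
  have hωlt : omegaL L p < p := ((formsAdmissible_iff_omegaL L).1 hadm).2 p hp
  have hpω : ((p : ℝ) - omegaL L p) ≠ 0 := by
    have : (omegaL L p : ℝ) < p := by exact_mod_cast hωlt
    linarith
  have hp1 : ((p : ℝ) - 1) ≠ 0 := by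
    have : (1 : ℝ) < p := by exact_mod_cast hp.one_lt
    linarith
  unfold eulerFactorM
  by_cases hc : p.Coprime (wCut k B * B) ∧ ¬ p ∣ M
  · rw [if_pos hc, if_pos hc, ← Finset.sum_div, sum_erase_abs_sPrimeM_eq hadm m hp]
    by_cases hpa : p ∣ (L m).1.natAbs
    · rw [if_pos hpa, if_pos hpa, zero_div, add_zero]
    · rw [if_neg hpa, if_neg hpa]
      generalize (if m ∈ admIdx L p then (0 : ℝ) else 1) = ι
      field_simp
      ring
  · rw [if_neg hc, if_neg hc, add_zero]

/-- `ω(p) ≥ 1` at a prime `p ∤ a_m` (the form `L_m` has a root mod `p`).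
[cite: Maynard2016DenseClusters, §7 p. 13] -/
theorem one_le_omegaL_of_not_dvd {L : Fin k → ℤ × ℤ} (hadm : FormsAdmissible L) (m : Fin k) {p : ℕ}
    (hp : p.Prime) (hpa : ¬ p ∣ (L m).1.natAbs) : 1 ≤ omegaL L p := by
  have h := card_admIdxM_add hadm m hp
  rw [if_neg hpa] at h
  omega

/-- The Euler factors of the absolute weight are `≥ 1`.
[cite: Maynard2016DenseClusters, proof of Lemma 9.3 p. 24 (first display)] -/
theorem one_le_eulerFactorM_abs_sPrime {L : Fin k → ℤ × ℤ} (hadm : FormsAdmissible L) (B : ℕ)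
    (m : Fin k) (M : ℕ) {p : ℕ} (hp : p.Prime) :
    1 ≤ eulerFactorM L B m M (fun p j => |sPrimeM L m j p| / ((p : ℝ) - omegaL L p)) p := by
  rw [eulerFactorM_abs_sPrime hadm B m M hp]
  have hωlt : omegaL L p < p := ((formsAdmissible_iff_omegaL L).1 hadm).2 p hp
  have hpω : 0 < (p : ℝ) - omegaL L p := by
    have : (omegaL L p : ℝ) < p := by exact_mod_cast hωlt
    linarith
  have hp1 : 0 < (p : ℝ) - 1 := by
    have : (1 : ℝ) < p := by exact_mod_cast hp.one_lt
    linarith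
  split_ifs with hc hpa hm
  · exact le_rfl
  · have hω1 : (1 : ℝ) ≤ omegaL L p := by exact_mod_cast one_le_omegaL_of_not_dvd hadm m hp hpa
    have : 0 ≤ ((omegaL L p : ℝ) - 1) / (((p : ℝ) - 1) * ((p : ℝ) - omegaL L p)) :=
      div_nonneg (by linarith) (mul_pos hp1 hpω).le
    rw [zero_div]; linarith
  · have hω1 : (1 : ℝ) ≤ omegaL L p := by exact_mod_cast one_le_omegaL_of_not_dvd hadm m hp hpa
    have h1 : 0 ≤ ((omegaL L p : ℝ) - 1) / (((p : ℝ) - 1) * ((p : ℝ) - omegaL L p)) :=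
      div_nonneg (by linarith) (mul_pos hp1 hpω).le
    have h2 : 0 ≤ 1 / ((p : ℝ) - omegaL L p) := div_nonneg zero_le_one hpω.le
    linarith
  · exact le_rfl

/-- **The `t`-indices sit on the primes of `Δ*_m`**: if `p ∤ a_m` and `m ∉ admIdx(p)` (the root of `L_m`
mod `p` is carried by an earlier form), then `p ∣ Δ*_m = ∏_{j ≠ m} |a_j b_m − a_m b_j|` («if `p ∣ W'_j/W_j`
then `p ∣ a_m b_j − a_j b_m`»; «we are summing over square-free `t ∣ Δ`»).
[cite: Maynard2016DenseClusters, proof of Lemma 9.3 pp. 23–24] -/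
theorem dvd_prod_crossDet_of_not_mem_admIdx {L : Fin k → ℤ × ℤ} (hadm : FormsAdmissible L)
    (m : Fin k) {p : ℕ} (hp : p.Prime) (hpa : ¬ p ∣ (L m).1.natAbs) (hm : m ∉ admIdx L p) :
    p ∣ ∏ j ∈ Finset.univ.erase m, (crossDet L m j).natAbs := by
  classical
  have h := card_deltaIdx_add hadm m hp
  rw [if_neg hm, if_neg hpa, add_zero] at h
  obtain ⟨j, hj⟩ := Finset.card_pos.1
    (by rw [h]; exact Nat.one_pos :
      0 < #(((admIdx L p).erase m).filter (fun j => p ∣ (crossDet L m j).natAbs)))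
  obtain ⟨hj1, hj2⟩ := Finset.mem_filter.1 hj
  have hjm : j ≠ m := Finset.ne_of_mem_erase hj1
  exact hj2.trans (Finset.dvd_prod_of_mem _ (Finset.mem_erase.2 ⟨hjm, Finset.mem_univ j⟩))

/-- `Δ*_m = ∏_{j ≠ m} |a_j b_m − a_m b_j| ≠ 0` for a non-degenerate family.
[cite: Maynard2016DenseClusters, proof of Lemma 9.3 p. 24 («t ∣ Δ»); FordGreenKonyaginMaynardTao2018, §7 p. 20 (non-proportional forms)] -/
theorem prod_crossDet_natAbs_ne_zero {L : Fin k → ℤ × ℤ} (hnd : FormsNondegenerate L) (m : Fin k) :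
    (∏ j ∈ Finset.univ.erase m, (crossDet L m j).natAbs) ≠ 0 := by
  refine Finset.prod_ne_zero_iff.2 fun j hj => ?_
  have hjm : j ≠ m := Finset.ne_of_mem_erase hj
  rw [ne_eq, Int.natAbs_eq_zero]
  unfold crossDet
  intro h
  exact hnd j m hjm (sub_eq_zero.1 h)


/-! ### §3 The inner error sum of (9.26): `∑_q |σ(q)|/φ_ω(∏q) · log ∏q ≪ ∏_{p∣Δ*}(1 + 1/p)(1 + ∑_{p∣Δ*} log p/p)` -/

/-- **The `s`-part is `O(1)`** (the tree's `MaynardDense.sum_sqfree_coprime_pow_mul_log_div_le` at a set of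
primes): for admissible `𝓛`, `k ≥ 2`, and any finite set `A` of primes coprime to `WB`,
`∑_{p ∈ A} k(1 + log p)/((p − 1)(p − ω(p))) ≤ e⁶` («the sum over s … can be seen to be O(1) since … we only
consider primes p > 2k²»). [cite: Maynard2016DenseClusters, proof of Lemma 9.3 p. 24 (first display)] -/
theorem sum_primes_mul_log_div_le {L : Fin k → ℤ × ℤ} (hadm : FormsAdmissible L) (hk : 2 ≤ k) (B : ℕ)
    (A : Finset ℕ) (hA : ∀ p ∈ A, p.Prime ∧ p.Coprime (wCut k B * B)) :
    ∑ p ∈ A, (k : ℝ) * (1 + Real.log p) / (((p : ℝ) - 1) * ((p : ℝ) - omegaL L p)) ≤ Real.exp 6 := by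
  have hK₀ : (2 : ℝ) ≤ k := by exact_mod_cast hk
  have hsmall : ∀ p : ℕ, p.Prime → (p : ℝ) ≤ 2 * (k : ℝ) ^ 2 → p ∣ wCut k B * B :=
    fun p hp hle => dvd_wCut_mul_of_le (k := k) (B := B) hp (by exact_mod_cast hle)
  have hωK : ∀ p : ℕ, p.Prime → ¬ p ∣ wCut k B * B → ((omegaL L p : ℕ) : ℝ) ≤ (k : ℝ) :=
    fun p hp _ => by exact_mod_cast omegaL_le_card_of_admissible hadm hp
  have hS : ∀ s ∈ A, Squarefree s ∧ Nat.Coprime s (wCut k B * B) := fun p hp =>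
    ⟨(hA p hp).1.prime.squarefree, (hA p hp).2⟩
  have h := MaynardDense.sum_sqfree_coprime_pow_mul_log_div_le (ω := fun p => omegaL L p)
    hK₀ hsmall hωK A hS
  refine le_trans (le_of_eq (Finset.sum_congr rfl fun p hp => ?_)) h
  have hpP := (hA p hp).1
  rw [hpP.primeFactors, Finset.card_singleton, pow_one, Finset.prod_singleton, Nat.totient_prime hpP,
    Nat.cast_sub hpP.one_le, Nat.cast_one]

/-- `1 + x ≤ exp x`-product: `∏_{i∈s} (1 + c i) ≤ exp(∑_{i∈s} c i)` for `c i ≥ 0`. [folklore] -/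
private theorem prod_one_add_le_exp_sum {ι : Type*} (s : Finset ι) {c : ι → ℝ} (hc : ∀ i ∈ s, 0 ≤ c i) :
    ∏ i ∈ s, (1 + c i) ≤ Real.exp (∑ i ∈ s, c i) := by
  rw [Real.exp_sum]
  exact Finset.prod_le_prod (fun i hi => by linarith [hc i hi]) fun i _ => by
    linarith [Real.add_one_le_exp (c i)]

/-- Monotonicity of a product of factors `≥ 1` in the index set (over `ℝ`). [folklore] -/
private theorem prod_le_prod_of_subset_of_one_le_real {ι : Type*} {s t : Finset ι} (h : s ⊆ t)
    {f : ι → ℝ} (hf : ∀ i ∈ t, 1 ≤ f i) : ∏ i ∈ s, f i ≤ ∏ i ∈ t, f i := by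
  classical
  rw [← Finset.prod_sdiff h]
  have h1 : 1 ≤ ∏ i ∈ t \ s, f i :=
    Finset.prod_induction f (fun x => 1 ≤ x) (fun a b ha hb => one_le_mul_of_one_le_of_one_le ha hb)
      le_rfl fun i hi => hf i (Finset.mem_sdiff.1 hi).1
  exact le_mul_of_one_le_left (Finset.prod_nonneg fun i hi => zero_le_one.trans (hf i (h hi))) h1

/-- **Maynard 2016, proof of Lemma 9.3, the inner sum of the error term (9.26)** (first display of p. 24,
«We first estimate the error term from (9.26)»): for admissible non-degenerate `𝓛`, `k ≥ 2`, square-free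
`N`, every `m`, `M`, `B`,
`∑_{q ∈ qBox N m M} |σ^{(m)}(q)|/φ_ω(∏q) · log ∏qᵢ ≤ 2e⁶e^{2e⁶} · ∏_{p∣Δ*_m}(1 + 1/p) · (1 + ∑_{p∣Δ*_m} log p/p)`,
`Δ*_m = ∏_{j≠m} |a_j b_m − a_m b_j|`. Printed: `log st ≪ …`, the `s`-sum «factorizes as an Euler product, which
can be seen to be O(1)», the `t`-sum is over square-free `t ∣ Δ` with «at most one possible 𝐭» per `t`, giving
`≪ (1 + ∑_{p∣Δ, p>2k²} log p/p) ∏_{p∣Δ, p>2k²}(1 + 1/φ_ω(p)) ≪ (log log Δ)²`; here the local factor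
`1 + 1/(p − ω(p))` is split as `(1 + 1/p)(1 + k/((p−1)(p−ω(p))))` so that only `∏_{p∣Δ}(1 + 1/p)` survives,
and the conversion `≪ (log log Δ)² ≪ (log log R)²` is left to the frame.
[cite: Maynard2016DenseClusters, proof of Lemma 9.3 p. 24 (first display after (9.26))] -/
theorem sum_qBox_abs_sigmaM_log_le {L : Fin k → ℤ × ℤ} (hadm : FormsAdmissible L)
    (hnd : FormsNondegenerate L) (hk : 2 ≤ k) (B : ℕ) {N : ℕ} (hN : Squarefree N) (m : Fin k) (M : ℕ) :
    ∑ q ∈ qBox L B N m M, |sigmaM L m q| / phiOmega L (∏ i, q i) * Real.log ((∏ i, q i : ℕ) : ℝ) ≤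
      2 * Real.exp 6 * Real.exp (2 * Real.exp 6) *
        (∏ p ∈ (∏ j ∈ Finset.univ.erase m, (crossDet L m j).natAbs).primeFactors, (1 + 1 / (p : ℝ))) *
        (1 + ∑ p ∈ (∏ j ∈ Finset.univ.erase m, (crossDet L m j).natAbs).primeFactors,
          Real.log p / p) := by
  classical
  set Δ := ∏ j ∈ Finset.univ.erase m, (crossDet L m j).natAbs with hΔdef
  have hΔ0 : Δ ≠ 0 := prod_crossDet_natAbs_ne_zero hnd m
  set s := N.primeFactors with hsdef
  have hs : ∀ p ∈ s, p.Prime := fun p hp => Nat.prime_of_mem_primeFactors hp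
  have hω : ∀ p : ℕ, p.Prime → omegaL L p < p := ((formsAdmissible_iff_omegaL L).1 hadm).2
  set E : ℕ → ℝ := fun p =>
    eulerFactorM L B m M (fun p j => |sPrimeM L m j p| / ((p : ℝ) - omegaL L p)) p with hEdef
  -- §1: the Euler bound
  have hNs : ∏ p ∈ s, p = N := Nat.prod_primeFactors_of_squarefree hN
  have h1 : ∑ q ∈ qBox L B N m M, |sigmaM L m q| / phiOmega L (∏ i, q i) *
      Real.log ((∏ i, q i : ℕ) : ℝ) ≤ (∏ p ∈ s, E p) * ∑ p ∈ s, (E p - 1) * Real.log p := by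
    have h := sum_qBox_mul_log_prod_le (L := L) (B := B) s hs m M
      (fun q => |sigmaM L m q| / phiOmega L (∏ i, q i))
      (fun p j => |sPrimeM L m j p| / ((p : ℝ) - omegaL L p))
      (fun p hp q hq hpq j => abs_sigmaM_div_phiOmega_update_mul L hω m hq (hs p hp) hpq j)
      (by
        show (0 : ℝ) ≤ |sigmaM L m fun _ => 1| / phiOmega L (∏ i : Fin k, (fun _ : Fin k => (1 : ℕ)) i)
        rw [sigmaM_one, Finset.prod_const_one, phiOmega_one]; norm_num)
      (fun p hp => one_le_eulerFactorM_abs_sPrime hadm B m M (hs p hp))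
    simp only [sigmaM_one, Finset.prod_const_one, phiOmega_one, abs_one, div_one, one_mul, hNs] at h
    exact h
  -- the active primes and the two local parts
  set A := s.filter (fun p => p.Coprime (wCut k B * B) ∧ ¬ p ∣ M ∧ ¬ p ∣ (L m).1.natAbs) with hAdef
  have hAprime : ∀ p ∈ A, p.Prime ∧ p.Coprime (wCut k B * B) := fun p hp =>
    ⟨hs p (Finset.mem_filter.1 hp).1, (Finset.mem_filter.1 hp).2.1⟩
  -- facts at an active prime
  have hfacts : ∀ p ∈ A, (1 : ℝ) ≤ omegaL L p ∧ (omegaL L p : ℝ) ≤ k ∧ (2 : ℝ) * k ^ 2 < p ∧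
      0 < (p : ℝ) - 1 ∧ 0 < (p : ℝ) - omegaL L p ∧ 0 ≤ Real.log p := by
    intro p hp
    obtain ⟨hps, hcop, -, hpa⟩ := Finset.mem_filter.1 hp
    have hpP := hs p hps
    have h1 : 1 ≤ omegaL L p := one_le_omegaL_of_not_dvd hadm m hpP hpa
    have h2 := omegaL_le_card_of_admissible hadm hpP
    have h3 : 2 * k ^ 2 < p := by
      by_contra hle
      have := dvd_wCut_mul_of_le (k := k) (B := B) hpP (not_lt.1 hle)
      exact (Nat.Prime.coprime_iff_not_dvd hpP).1 hcop this
    have h4 := hω p hpP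
    refine ⟨by exact_mod_cast h1, by exact_mod_cast h2, by exact_mod_cast h3, ?_, ?_,
      Real.log_nonneg (by exact_mod_cast hpP.one_lt.le)⟩
    · have : (1 : ℝ) < p := by exact_mod_cast hpP.one_lt
      linarith
    · have : (omegaL L p : ℝ) < p := by exact_mod_cast h4
      linarith
  -- σ-part `a`, τ-part `b`, majorant `c`, and `d = [t-prime]/p`
  set a : ℕ → ℝ := fun p =>
    if p ∈ A then ((omegaL L p : ℝ) - 1) / (((p : ℝ) - 1) * ((p : ℝ) - omegaL L p)) else 0 with hadef
  set b : ℕ → ℝ := fun p =>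
    if p ∈ A ∧ m ∉ admIdx L p then 1 / ((p : ℝ) - omegaL L p) else 0 with hbdef
  set c : ℕ → ℝ := fun p =>
    if p ∈ A then (k : ℝ) * (1 + Real.log p) / (((p : ℝ) - 1) * ((p : ℝ) - omegaL L p)) else 0
    with hcdef
  set d : ℕ → ℝ := fun p => if p ∈ A ∧ m ∉ admIdx L p then 1 / (p : ℝ) else 0 with hddef
  have hE : ∀ p ∈ s, E p = 1 + a p + b p := by
    intro p hps
    have hpP := hs p hps
    simp only [hEdef, hadef, hbdef]
    rw [eulerFactorM_abs_sPrime hadm B m M hpP]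
    by_cases hc1 : p.Coprime (wCut k B * B) ∧ ¬ p ∣ M
    · rw [if_pos hc1]
      by_cases hpa : p ∣ (L m).1.natAbs
      · have hnA : p ∉ A := fun h => (Finset.mem_filter.1 h).2.2.2 hpa
        rw [if_pos hpa, if_neg hnA, if_neg (fun h => hnA h.1)]
        ring
      · have hA1 : p ∈ A := Finset.mem_filter.2 ⟨hps, hc1.1, hc1.2, hpa⟩
        rw [if_neg hpa, if_pos hA1]
        by_cases hm : m ∈ admIdx L p
        · rw [if_pos hm, if_neg (fun h => h.2 hm)]
          ring
        · rw [if_neg hm, if_pos ⟨hA1, hm⟩]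
    · have hnA : p ∉ A := fun h => hc1 ⟨(Finset.mem_filter.1 h).2.1, (Finset.mem_filter.1 h).2.2.1⟩
      rw [if_neg hc1, if_neg hnA, if_neg (fun h => hnA h.1)]
      ring
  -- the key analytic input
  have hcsum : ∑ p ∈ s, c p ≤ Real.exp 6 := by
    have hsub : ∑ p ∈ s, c p =
        ∑ p ∈ A, (k : ℝ) * (1 + Real.log p) / (((p : ℝ) - 1) * ((p : ℝ) - omegaL L p)) := by
      rw [hAdef, Finset.sum_filter]
      refine Finset.sum_congr rfl fun p hp => ?_
      simp only [hcdef, hAdef, Finset.mem_filter]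
      by_cases h : p.Coprime (wCut k B * B) ∧ ¬ p ∣ M ∧ ¬ p ∣ (L m).1.natAbs
      · rw [if_pos ⟨hp, h⟩, if_pos h]
      · rw [if_neg (fun h' => h h'.2), if_neg h]
    rw [hsub]
    exact sum_primes_mul_log_div_le hadm hk B A hAprime
  -- pointwise inequalities
  have hk1 : (1 : ℝ) ≤ k := by
    have : (2 : ℝ) ≤ k := by exact_mod_cast hk
    linarith
  have ha0 : ∀ p ∈ s, 0 ≤ a p := by
    intro p _
    simp only [hadef]
    split_ifs with hp
    · obtain ⟨h1, -, -, h4, h5, -⟩ := hfacts p hp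
      exact div_nonneg (by linarith) (mul_pos h4 h5).le
    · exact le_rfl
  have hb0 : ∀ p ∈ s, 0 ≤ b p := by
    intro p _
    simp only [hbdef]
    split_ifs with hp
    · obtain ⟨-, -, -, -, h5, -⟩ := hfacts p hp.1
      exact div_nonneg zero_le_one h5.le
    · exact le_rfl
  have hc0 : ∀ p ∈ s, 0 ≤ c p := by
    intro p _
    simp only [hcdef]
    split_ifs with hp
    · obtain ⟨-, -, -, h4, h5, h6⟩ := hfacts p hp
      exact div_nonneg (mul_nonneg (by linarith) (by linarith)) (mul_pos h4 h5).le
    · exact le_rfl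
  have hd0 : ∀ p ∈ s, 0 ≤ d p := by
    intro p _
    simp only [hddef]
    split_ifs
    · positivity
    · exact le_rfl
  have hac : ∀ p ∈ s, a p ≤ c p := by
    intro p _
    simp only [hadef, hcdef]
    split_ifs with hp
    · obtain ⟨h1, h2, -, h4, h5, h6⟩ := hfacts p hp
      refine div_le_div_of_nonneg_right ?_ (mul_pos h4 h5).le
      nlinarith
    · exact le_rfl
  have halog : ∀ p ∈ s, a p * Real.log p ≤ c p := by
    intro p _
    simp only [hadef, hcdef]
    split_ifs with hp
    · obtain ⟨h1, h2, -, h4, h5, h6⟩ := hfacts p hp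
      rw [div_mul_eq_mul_div]
      refine div_le_div_of_nonneg_right ?_ (mul_pos h4 h5).le
      nlinarith
    · rw [zero_mul]
  have hblog : ∀ p ∈ s, b p * Real.log p ≤ 2 * (d p * Real.log p) := by
    intro p _
    simp only [hbdef, hddef]
    split_ifs with hp
    · obtain ⟨h1, h2, h3, h4, h5, h6⟩ := hfacts p hp.1
      have hp0 : (0 : ℝ) < p := by linarith
      -- 1/(p − ω) ≤ 2/p since ω ≤ k ≤ p/2
      have hkp : (k : ℝ) ≤ p / 2 := by nlinarith
      have hle : 1 / ((p : ℝ) - omegaL L p) ≤ 2 * (1 / (p : ℝ)) := by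
        rw [mul_one_div, div_le_div_iff₀ h5 hp0, one_mul]
        nlinarith
      nlinarith
    · simp
  have hbd : ∀ p ∈ s, 1 + b p ≤ (1 + d p) * (1 + c p) := by
    intro p hps
    by_cases hp : p ∈ A ∧ m ∉ admIdx L p
    · have eb : b p = 1 / ((p : ℝ) - omegaL L p) := by simp only [hbdef, if_pos hp]
      have ed : d p = 1 / (p : ℝ) := by simp only [hddef, if_pos hp]
      have ec : c p = (k : ℝ) * (1 + Real.log p) / (((p : ℝ) - 1) * ((p : ℝ) - omegaL L p)) := by
        simp only [hcdef, if_pos hp.1]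
      rw [eb, ed, ec]
      obtain ⟨h1, h2, h3, h4, h5, h6⟩ := hfacts p hp.1
      have hp0 : (0 : ℝ) < p := by linarith
      -- 1/(p−ω) ≤ 1/p + k(1+log p)/((p−1)(p−ω)) and the cross term is ≥ 0
      have hkey : 1 / ((p : ℝ) - omegaL L p) ≤
          1 / (p : ℝ) + (k : ℝ) * (1 + Real.log p) / (((p : ℝ) - 1) * ((p : ℝ) - omegaL L p)) := by
        rw [div_add_div _ _ hp0.ne' (mul_pos h4 h5).ne', le_div_iff₀ (by positivity)]
        have : 1 / ((p : ℝ) - omegaL L p) * ((p : ℝ) * (((p : ℝ) - 1) * ((p : ℝ) - omegaL L p))) =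
            (p : ℝ) * ((p : ℝ) - 1) := by field_simp
        rw [this]
        have e1 : ((p : ℝ) - 1) * (omegaL L p : ℝ) ≤ (p : ℝ) * k := by nlinarith
        have e2 : (p : ℝ) * k ≤ (p : ℝ) * ((k : ℝ) * (1 + Real.log p)) := by
          have : (k : ℝ) ≤ (k : ℝ) * (1 + Real.log p) := by nlinarith
          exact mul_le_mul_of_nonneg_left this hp0.le
        nlinarith [e1, e2]
      have hcross : 0 ≤ 1 / (p : ℝ) * ((k : ℝ) * (1 + Real.log p) /
          (((p : ℝ) - 1) * ((p : ℝ) - omegaL L p))) := by positivity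
      nlinarith
    · have eb : b p = 0 := by simp only [hbdef, if_neg hp]
      have ed : d p = 0 := by simp only [hddef, if_neg hp]
      rw [eb, ed, add_zero]
      linarith [hc0 p hps]
  -- Σ (E − 1) log p ≤ e⁶ + 2 Σ_Δ log p/p
  have hDsub : s.filter (fun p => p ∈ A ∧ m ∉ admIdx L p) ⊆ Δ.primeFactors := by
    intro p hp
    obtain ⟨hps, hpA, hm⟩ := Finset.mem_filter.1 hp
    have hpP := hs p hps
    have hpa : ¬ p ∣ (L m).1.natAbs := (Finset.mem_filter.1 hpA).2.2.2
    exact Nat.mem_primeFactors.2 ⟨hpP, dvd_prod_crossDet_of_not_mem_admIdx hadm m hpP hpa hm, hΔ0⟩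
  have hsumd : ∑ p ∈ s, d p * Real.log p ≤ ∑ p ∈ Δ.primeFactors, Real.log p / p := by
    have : ∑ p ∈ s, d p * Real.log p =
        ∑ p ∈ s.filter (fun p => p ∈ A ∧ m ∉ admIdx L p), Real.log p / p := by
      rw [Finset.sum_filter]
      refine Finset.sum_congr rfl fun p _ => ?_
      simp only [hddef]
      split_ifs
      · ring
      · rw [zero_mul]
    rw [this]
    refine Finset.sum_le_sum_of_subset_of_nonneg hDsub fun p hp _ => ?_
    have hpP := Nat.prime_of_mem_primeFactors hp
    exact div_nonneg (Real.log_nonneg (by exact_mod_cast hpP.one_lt.le)) (by positivity)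
  have hsum : ∑ p ∈ s, (E p - 1) * Real.log p ≤
      Real.exp 6 + 2 * ∑ p ∈ Δ.primeFactors, Real.log p / p := by
    calc ∑ p ∈ s, (E p - 1) * Real.log p = ∑ p ∈ s, (a p * Real.log p + b p * Real.log p) := by
          refine Finset.sum_congr rfl fun p hp => ?_
          rw [hE p hp]; ring
      _ ≤ ∑ p ∈ s, (c p + 2 * (d p * Real.log p)) :=
          Finset.sum_le_sum fun p hp => add_le_add (halog p hp) (hblog p hp)
      _ = ∑ p ∈ s, c p + 2 * ∑ p ∈ s, d p * Real.log p := by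
          rw [Finset.sum_add_distrib, Finset.mul_sum]
      _ ≤ Real.exp 6 + 2 * ∑ p ∈ Δ.primeFactors, Real.log p / p := by
          linarith [hcsum, hsumd]
  -- ∏ E ≤ e^{2e⁶} ∏_Δ (1 + 1/p)
  have hprodd : ∏ p ∈ s, (1 + d p) ≤ ∏ p ∈ Δ.primeFactors, (1 + 1 / (p : ℝ)) := by
    have : ∏ p ∈ s, (1 + d p) = ∏ p ∈ s.filter (fun p => p ∈ A ∧ m ∉ admIdx L p), (1 + 1 / (p : ℝ)) := by
      rw [Finset.prod_filter]
      refine Finset.prod_congr rfl fun p _ => ?_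
      simp only [hddef]
      split_ifs
      · rfl
      · rw [add_zero]
    rw [this]
    exact prod_le_prod_of_subset_of_one_le_real hDsub fun p _ => by
      have : (0 : ℝ) ≤ 1 / (p : ℝ) := by positivity
      linarith
  have hprod : ∏ p ∈ s, E p ≤
      Real.exp (2 * Real.exp 6) * ∏ p ∈ Δ.primeFactors, (1 + 1 / (p : ℝ)) := by
    calc ∏ p ∈ s, E p = ∏ p ∈ s, (1 + a p + b p) := Finset.prod_congr rfl hE
      _ ≤ ∏ p ∈ s, ((1 + c p) * (1 + c p) * (1 + d p)) := by
          refine Finset.prod_le_prod (fun p hp => by linarith [ha0 p hp, hb0 p hp]) fun p hp => ?_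
          have h1 : 1 + a p + b p ≤ (1 + a p) * (1 + b p) := by nlinarith [ha0 p hp, hb0 p hp]
          have h2 : (1 + a p) * (1 + b p) ≤ (1 + c p) * ((1 + d p) * (1 + c p)) :=
            mul_le_mul (by linarith [hac p hp]) (hbd p hp) (by linarith [hb0 p hp])
              (by linarith [hc0 p hp])
          nlinarith
      _ = (∏ p ∈ s, (1 + c p)) * (∏ p ∈ s, (1 + c p)) * ∏ p ∈ s, (1 + d p) := by
          rw [Finset.prod_mul_distrib, Finset.prod_mul_distrib]
      _ ≤ Real.exp (∑ p ∈ s, c p) * Real.exp (∑ p ∈ s, c p) *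
            ∏ p ∈ Δ.primeFactors, (1 + 1 / (p : ℝ)) := by
          have hP := prod_one_add_le_exp_sum s hc0
          have hPn : 0 ≤ ∏ p ∈ s, (1 + c p) := Finset.prod_nonneg fun p hp => by linarith [hc0 p hp]
          have hDn : 0 ≤ ∏ p ∈ s, (1 + d p) := Finset.prod_nonneg fun p hp => by linarith [hd0 p hp]
          exact mul_le_mul (mul_le_mul hP hP hPn (Real.exp_pos _).le) hprodd hDn (by positivity)
      _ ≤ Real.exp (2 * Real.exp 6) * ∏ p ∈ Δ.primeFactors, (1 + 1 / (p : ℝ)) := by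
          rw [← Real.exp_add]
          refine mul_le_mul_of_nonneg_right (Real.exp_le_exp.2 (by linarith [hcsum])) ?_
          exact Finset.prod_nonneg fun p _ => by positivity
  -- combine
  have hPn2 : 0 ≤ ∏ p ∈ Δ.primeFactors, (1 + 1 / (p : ℝ)) := Finset.prod_nonneg fun p _ => by positivity
  have hSn2 : 0 ≤ ∑ p ∈ Δ.primeFactors, Real.log p / p := Finset.sum_nonneg fun p hp => by
    have hpP := Nat.prime_of_mem_primeFactors hp
    exact div_nonneg (Real.log_nonneg (by exact_mod_cast hpP.one_lt.le)) (by positivity)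
  have hEn : 0 ≤ ∏ p ∈ s, E p := Finset.prod_nonneg fun p hp =>
    zero_le_one.trans (one_le_eulerFactorM_abs_sPrime hadm B m M (hs p hp))
  have hSn : 0 ≤ ∑ p ∈ s, (E p - 1) * Real.log p := Finset.sum_nonneg fun p hp =>
    mul_nonneg (by linarith [one_le_eulerFactorM_abs_sPrime hadm B m M (hs p hp)])
      (Real.log_nonneg (by exact_mod_cast (hs p hp).one_lt.le))
  have he6 : (1 : ℝ) ≤ Real.exp 6 := Real.one_le_exp (by norm_num)
  calc ∑ q ∈ qBox L B N m M, |sigmaM L m q| / phiOmega L (∏ i, q i) * Real.log ((∏ i, q i : ℕ) : ℝ)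
      ≤ (∏ p ∈ s, E p) * ∑ p ∈ s, (E p - 1) * Real.log p := h1
    _ ≤ (Real.exp (2 * Real.exp 6) * ∏ p ∈ Δ.primeFactors, (1 + 1 / (p : ℝ))) *
          (Real.exp 6 + 2 * ∑ p ∈ Δ.primeFactors, Real.log p / p) :=
        mul_le_mul hprod hsum hSn (by positivity)
    _ ≤ 2 * Real.exp 6 * Real.exp (2 * Real.exp 6) *
          (∏ p ∈ Δ.primeFactors, (1 + 1 / (p : ℝ))) *
          (1 + ∑ p ∈ Δ.primeFactors, Real.log p / p) := by
        have : Real.exp 6 + 2 * ∑ p ∈ Δ.primeFactors, Real.log p / p ≤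
            2 * Real.exp 6 * (1 + ∑ p ∈ Δ.primeFactors, Real.log p / p) := by nlinarith
        calc (Real.exp (2 * Real.exp 6) * ∏ p ∈ Δ.primeFactors, (1 + 1 / (p : ℝ))) *
              (Real.exp 6 + 2 * ∑ p ∈ Δ.primeFactors, Real.log p / p)
            ≤ (Real.exp (2 * Real.exp 6) * ∏ p ∈ Δ.primeFactors, (1 + 1 / (p : ℝ))) *
              (2 * Real.exp 6 * (1 + ∑ p ∈ Δ.primeFactors, Real.log p / p)) :=
              mul_le_mul_of_nonneg_left this (by positivity)
          _ = _ := by ring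

end FGKMT2018

end Literature.NumberTheory.Sieve
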